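import Mathlib
import HarnessLib
import Summits.HubbardSuperconductivity.HubbardSuperconductivity.Theorems.KLProgrammeH10TwoPointLimitKlAnisoNarrowConeBricks

/-!
# Route `KLProgramme` — K3 engine (stmt-HubbardSuperconductivity-20437), stub (b) (ℓ)/(I2), located item «ON-CLASS-KB» (K′):
# the NARROW (double-cone) count — on the umklapp-active class, the coarse tuples whose non-pinned legs all lie within `C′` sectors of one LINE
# (direction `b` or its antipode `b + N/2`, after sign absorption) number `O(m)·(8(2C′+1))^m`, uniformly in the scale

Cell gate-hubbard-kl, seat p4 g13 (memo HOME/prover-p4/CLAIM-U-API.md §3b).  The complement of the WIDE on-class row (`…KlAnisoOnUmklappCountWide`, whose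
transversality `pairAngle` is an angle MOD π) is the DOUBLE-cone class: all non-pinned half-turned indices within `C′` of a common sector `b` modulo
`N/2 = 2^k` (near `b` OR near its antipode).  It is small: each non-pinned leg's signed centre point is `± P(θ_b)` up to `Lip·C′·w_k`, so the signed sum
is `n·P(θ_b) + O(tol)` with an INTEGER multiplicity `n`, `|n| ≤ m`; conservation with target `2πG₀` forces `n·P(θ_b) ≈ V := 2πG₀ − (pinned signed point)`,
and `n ≠ 0` as soon as `‖V‖_∞ > tol` (hypothesis `hV`; for the frame's curve `‖V‖_∞ ≥ min(u_min/√2, 2π − π√2)`).  Two admissible `(b, n)`, `(b′, n′)` then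
give polar points of radii `≥ u_min` that are `2·tol`-close, so `θ_b ≡ θ_{b′}` (mod π) up to `2π·tol/u_min`: `O(m)` choices of `b`; given `b` each
non-pinned leg has `≤ 8(2C′+1)` labels (offset, cone, spin, charge).  Stated for an ABSTRACT centre map `P` (polar with radius `≥ u_min`, centrally
symmetric, `Lip`-continuous for the torus distance), like `…KlAnisoTightBundleCount`.

(Bricks — cone reduction `exists_sign_apply_centre_of_two_pow_dvd`, `int_mul_polar_eq` — in `…KlAnisoNarrowConeBricks`.)
* **`card_narrowCone_target_le`** — the count `≤ 2·(8π((m+1)C + m·Lip·C′)/u_min + 2)·(8(2C′+1))^m`.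
PROVED; no definitions, no named facts; nothing here asserts anything about the model or superconductivity. [folklore] counting.
-/

noncomputable section

namespace Summit.HubbardSuperconductivity.HubbardSuperconductivity.Theorems.PerturbedFermiCurve

set_option linter.dupNamespace false -- summit = problem name (single-conjunct summit), D-0017

open Classical
open Real Set Finset
open Literature.MathematicalPhysics.QuantumLattice Literature.MathematicalPhysics.QuantumLattice.BandSectorCounting
open Literature.MathematicalPhysics.QuantumLattice.FermiRG Literature.MathematicalPhysics.QuantumLattice.FermiRG.BGM2003

/-! ## The narrow (double-cone) count -/

/-- **THE NARROW-CONE COUNT (K′).**  Let `P : ℝ → ℝ²` be polar with radius `≥ u_min > 0`, centrally symmetric and `Lip`-continuous for the torus distance.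
Fix the scale `k`, `m + 1` legs, the pinned leg `p` with its label `ℓ`, a reciprocal vector `G₀`, `C ≥ 0`, a cluster radius `C′`, and assume the target
`V = 2πG₀ − (pinned signed point)` has a coordinate exceeding `tol := ((m+1)C + m·Lip·C′)·w_k`.  The coarse label tuples `σ′` with `σ′ p = ℓ`, signed centre
points summing to within `(m+1)·C·w_k` of `2πG₀` coordinatewise, and all non-pinned half-turned indices within `C′` of a common sector `b` MODULO `2^k = N/2`
(near `b` or near its antipode), number at most `2·(8π((m+1)C + m·Lip·C′)/u_min + 2)·(8(2C′+1))^m` — uniformly in `k`. [folklore] -/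
theorem card_narrowCone_target_le (P : ℝ → (Fin 2 → ℝ)) {umin Lip : ℝ} (humin : 0 < umin) (hLip0 : 0 ≤ Lip)
    (hpolar : ∀ θ, ∃ r : ℝ, umin ≤ r ∧ P θ = r • dir θ) (hanti : ∀ θ, P (θ + π) = -P θ)
    (hLip : ∀ θ θ' : ℝ, ∀ j : Fin 2, |P θ j - P θ' j| ≤ Lip * FermiRG.torusDist (θ - θ'))
    {k m : ℕ} (p : Fin (m + 1)) (ℓ : SectorLeg (sectorCount k)) (G₀ : Fin 2 → ℤ) {C : ℝ} (hC : 0 ≤ C) (C' : ℕ)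
    (hV : ∃ j : Fin 2, (((m : ℝ) + 1) * C + m * Lip * C') * sectorWidth k <
      |2 * π * (G₀ j : ℝ) - (if ℓ.2 = 0 then P (sectorCenter k ℓ.1.1) j else -P (sectorCenter k ℓ.1.1) j)|) :
    (((univ : Finset (Fin (m + 1) → SectorLeg (sectorCount k))).filter fun σ' =>
        σ' p = ℓ ∧
        (∀ j : Fin 2, |∑ i, (if (σ' i).2 = 0 then P (sectorCenter k (σ' i).1.1) j else -P (sectorCenter k (σ' i).1.1) j) -
            2 * π * (G₀ j : ℝ)| ≤ ((m : ℝ) + 1) * C * sectorWidth k) ∧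
        ∃ b : Fin (sectorCount k), ∀ i, i ≠ p → ∃ D : ℤ, |D| ≤ C' ∧ ((2 : ℤ) ^ k) ∣
          ((((if (σ' i).2 = 0 then ((σ' i).1.1 : ℕ) else
              if ((σ' i).1.1 : ℕ) < 2 ^ k then ((σ' i).1.1 : ℕ) + 2 ^ k else ((σ' i).1.1 : ℕ) - 2 ^ k : ℕ) : ℤ)) - b - D)).card : ℝ) ≤
      2 * (8 * π * (((m : ℝ) + 1) * C + m * Lip * C') / umin + 2) * (8 * (2 * (C' : ℝ) + 1)) ^ m := by
  have hw := sectorWidth_pos k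
  have hN := sectorCount_pos k
  have hπ := Real.pi_pos
  have hNeq : sectorCount k = 2 * 2 ^ k := by unfold sectorCount; ring
  -- notation
  set tol : ℝ := (((m : ℝ) + 1) * C + m * Lip * C') * sectorWidth k with htol
  have htol0 : 0 ≤ tol := by positivity
  set V : Fin 2 → ℝ := fun j => 2 * π * (G₀ j : ℝ) - (if ℓ.2 = 0 then P (sectorCenter k ℓ.1.1) j else -P (sectorCenter k ℓ.1.1) j) with hVdef
  set ht : SectorLeg (sectorCount k) → ℕ := fun x =>
    if x.2 = 0 then (x.1.1 : ℕ) else if (x.1.1 : ℕ) < 2 ^ k then (x.1.1 : ℕ) + 2 ^ k else (x.1.1 : ℕ) - 2 ^ k with hht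
  have ht_lt : ∀ x : SectorLeg (sectorCount k), ht x < sectorCount k := by
    intro x; simp only [hht]
    by_cases h0 : x.2 = 0
    · rw [if_pos h0]; exact x.1.1.isLt
    · rw [if_neg h0]; exact halfTurnIdx_lt false x.1.1.isLt
  set S := (univ : Finset (Fin (m + 1) → SectorLeg (sectorCount k))).filter fun σ' =>
      σ' p = ℓ ∧
      (∀ j : Fin 2, |∑ i, (if (σ' i).2 = 0 then P (sectorCenter k (σ' i).1.1) j else -P (sectorCenter k (σ' i).1.1) j) -
          2 * π * (G₀ j : ℝ)| ≤ ((m : ℝ) + 1) * C * sectorWidth k) ∧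
      ∃ b : Fin (sectorCount k), ∀ i, i ≠ p → ∃ D : ℤ, |D| ≤ C' ∧ ((2 : ℤ) ^ k) ∣ (((ht (σ' i) : ℕ) : ℤ) - b - D) with hS
  have hSdef' : ∀ σ', σ' ∈ S ↔ σ' p = ℓ ∧
      (∀ j : Fin 2, |∑ i, (if (σ' i).2 = 0 then P (sectorCenter k (σ' i).1.1) j else -P (sectorCenter k (σ' i).1.1) j) -
          2 * π * (G₀ j : ℝ)| ≤ ((m : ℝ) + 1) * C * sectorWidth k) ∧
      ∃ b : Fin (sectorCount k), ∀ i, i ≠ p → ∃ D : ℤ, |D| ≤ C' ∧ ((2 : ℤ) ^ k) ∣ (((ht (σ' i) : ℕ) : ℤ) - b - D) := by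
    intro σ'; rw [hS, mem_filter]; exact ⟨fun h => h.2, fun h => ⟨mem_univ _, h⟩⟩
  show ((S.card : ℕ) : ℝ) ≤ _
  -- §a the fibre over a cone sector `b`: offset, cone bit, spin, charge
  set Lbl : Fin (sectorCount k) → Finset (SectorLeg (sectorCount k)) := fun b =>
    univ.filter fun x => ∃ D : ℤ, |D| ≤ C' ∧ ((2 : ℤ) ^ k) ∣ (((ht x : ℕ) : ℤ) - b - D) with hLbl
  have hLbl_card : ∀ b, ((Lbl b).card : ℝ) ≤ 8 * (2 * (C' : ℝ) + 1) := by
    intro b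
    have hmem : ∀ x ∈ Lbl b, ∃ D : ℤ, |D| ≤ C' ∧ ((2 : ℤ) ^ k) ∣ (((ht x : ℕ) : ℤ) - b - D) := by
      intro x hx; rw [hLbl, mem_filter] at hx; exact hx.2
    choose! Df hDf using hmem
    set g : SectorLeg (sectorCount k) → ℤ × Bool × Fin 2 × Fin 2 := fun x => (Df x, decide (2 ^ k ≤ ht x), x.1.2, x.2) with hg
    have hinj : Set.InjOn g (Lbl b) := by
      intro x hx y hy hxy
      have hx' := hDf x (Finset.mem_coe.1 hx); have hy' := hDf y (Finset.mem_coe.1 hy)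
      simp only [hg, Prod.mk.injEq] at hxy
      obtain ⟨hD, hcone, hsp, hch⟩ := hxy
      have hcone' : (2 ^ k ≤ ht x ↔ 2 ^ k ≤ ht y) := by simpa using hcone
      have hcong : ((2 : ℤ) ^ k) ∣ (((ht x : ℕ) : ℤ) - ((ht y : ℕ) : ℤ)) := by
        have := dvd_sub hx'.2 hy'.2
        rw [hD] at this
        have e : ((ht x : ℕ) : ℤ) - b - Df y - (((ht y : ℕ) : ℤ) - b - Df y) = ((ht x : ℕ) : ℤ) - ((ht y : ℕ) : ℤ) := by ring
        rwa [e] at this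
      have heq : ht x = ht y := by
        have h1 := ht_lt x; have h2 := ht_lt y
        rw [hNeq] at h1 h2
        rcases hcong with ⟨t, htt⟩
        have hK : (0 : ℤ) < (2 : ℤ) ^ k := by positivity
        have h1' : ((ht x : ℕ) : ℤ) < 2 * 2 ^ k := by exact_mod_cast h1
        have h2' : ((ht y : ℕ) : ℤ) < 2 * 2 ^ k := by exact_mod_cast h2
        have : t = 0 := by
          by_contra hne
          rcases lt_or_gt_of_ne hne with hlt | hgt
          · -- `ht y ≥ ht x + 2^k` ⇒ `ht y ≥ 2^k > ht x`: cone bits differ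
            have : t ≤ -1 := by omega
            have hyx : ((ht y : ℕ) : ℤ) ≥ ((ht x : ℕ) : ℤ) + 2 ^ k := by nlinarith
            have hy2 : 2 ^ k ≤ ht y := by exact_mod_cast (show ((2 : ℕ) ^ k : ℤ) ≤ ht y by push_cast; linarith [Int.natCast_nonneg (ht x)])
            have hx2 : ¬ 2 ^ k ≤ ht x := by
              intro hle
              have : ((2 ^ k : ℕ) : ℤ) ≤ ht x := by exact_mod_cast hle
              push_cast at this; linarith
            exact hx2 (hcone'.2 hy2)
          · have : 1 ≤ t := by omega
            have hxy' : ((ht x : ℕ) : ℤ) ≥ ((ht y : ℕ) : ℤ) + 2 ^ k := by nlinarith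
            have hx2 : 2 ^ k ≤ ht x := by exact_mod_cast (show ((2 : ℕ) ^ k : ℤ) ≤ ht x by push_cast; linarith [Int.natCast_nonneg (ht y)])
            have hy2 : ¬ 2 ^ k ≤ ht y := by
              intro hle
              have : ((2 ^ k : ℕ) : ℤ) ≤ ht y := by exact_mod_cast hle
              push_cast at this; linarith
            exact hy2 (hcone'.1 hx2)
        rw [this, mul_zero, sub_eq_zero] at htt
        exact_mod_cast htt
      have hidx : (x.1.1 : ℕ) = (y.1.1 : ℕ) := by
        have hx2 : ht x = (if decide (x.2 = 0) then (x.1.1 : ℕ) else if (x.1.1 : ℕ) < 2 ^ k then (x.1.1 : ℕ) + 2 ^ k else (x.1.1 : ℕ) - 2 ^ k) := by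
          simp only [hht]; by_cases h0 : x.2 = 0 <;> simp [h0]
        have hy2 : ht y = (if decide (x.2 = 0) then (y.1.1 : ℕ) else if (y.1.1 : ℕ) < 2 ^ k then (y.1.1 : ℕ) + 2 ^ k else (y.1.1 : ℕ) - 2 ^ k) := by
          simp only [hht]; rw [← hch]; by_cases h0 : x.2 = 0 <;> simp [h0]
        rw [hx2, hy2] at heq
        exact halfTurnIdx_injOn _ x.1.1.isLt y.1.1.isLt heq
      exact Prod.ext (Prod.ext (Fin.ext hidx) hsp) hch
    have hrange : ∀ x ∈ Lbl b, g x ∈ (Finset.Icc (-(C' : ℤ)) C') ×ˢ ((univ : Finset Bool) ×ˢ ((univ : Finset (Fin 2)) ×ˢ (univ : Finset (Fin 2)))) := by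
      intro x hx
      rw [Finset.mem_product, Finset.mem_product, Finset.mem_product, Finset.mem_Icc]
      exact ⟨abs_le.1 (hDf x hx).1, mem_univ _, mem_univ _, mem_univ _⟩
    have hc := Finset.card_le_card_of_injOn g hrange hinj
    rw [Finset.card_product, Finset.card_product, Finset.card_product, Finset.card_univ, Finset.card_univ, Fintype.card_bool,
      Fintype.card_fin, Int.card_Icc] at hc
    have e : (((C' : ℤ) + 1 - -(C' : ℤ)).toNat : ℝ) = 2 * C' + 1 := by
      have : (C' : ℤ) + 1 - -(C' : ℤ) = ((2 * C' + 1 : ℕ) : ℤ) := by push_cast; ring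
      rw [this, Int.toNat_natCast]; push_cast; ring
    have : ((Lbl b).card : ℝ) ≤ (((C' : ℤ) + 1 - -(C' : ℤ)).toNat * (2 * (2 * 2)) : ℕ) := by exact_mod_cast hc
    rw [Nat.cast_mul, e] at this
    push_cast at this
    linarith
  set T : Fin (sectorCount k) → Finset (Fin (m + 1) → SectorLeg (sectorCount k)) := fun b =>
    Fintype.piFinset fun i => if i = p then {ℓ} else Lbl b with hT
  have hT_card : ∀ b, ((T b).card : ℝ) ≤ (8 * (2 * (C' : ℝ) + 1)) ^ m := by
    intro b
    rw [hT, Fintype.card_piFinset]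
    have h1 : ∀ i, (((if i = p then ({ℓ} : Finset _) else Lbl b).card : ℕ) : ℝ) ≤ if i = p then 1 else 8 * (2 * (C' : ℝ) + 1) := by
      intro i; by_cases hi : i = p
      · simp [hi]
      · rw [if_neg hi, if_neg hi]; exact hLbl_card b
    calc (((∏ i, (if i = p then ({ℓ} : Finset _) else Lbl b).card : ℕ) : ℝ)) = ∏ i, (((if i = p then ({ℓ} : Finset _) else Lbl b).card : ℕ) : ℝ) := by
          push_cast; rfl
      _ ≤ ∏ i : Fin (m + 1), (if i = p then (1 : ℝ) else 8 * (2 * (C' : ℝ) + 1)) :=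
          Finset.prod_le_prod (fun i _ => by positivity) (fun i _ => h1 i)
      _ = (8 * (2 * (C' : ℝ) + 1)) ^ m := by
          rw [Finset.prod_ite, Finset.prod_const_one, one_mul, Finset.prod_const]
          congr 1
          have : (univ.filter fun i : Fin (m + 1) => ¬ i = p) = univ.erase p := by ext i; simp
          rw [this, Finset.card_erase_of_mem (mem_univ _), Finset.card_univ, Fintype.card_fin]; rfl
  -- §b empty or not
  rcases S.eq_empty_or_nonempty with hS0 | ⟨σ₀, hσ₀⟩
  · rw [hS0, Finset.card_empty, Nat.cast_zero]; positivity
  obtain ⟨hσ₀p, hon₀, b₀', hb₀'⟩ := (hSdef' σ₀).1 hσ₀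
  -- §c the multiplicity estimate for one admissible `(σ′, b)`: `∃ n ∈ ℤ, |n| ≤ m, n ≠ 0, |n·P(θ_b) − V| ≤ tol`
  have hkey : ∀ σ' ∈ S, ∀ b : Fin (sectorCount k),
      (∀ i, i ≠ p → ∃ D : ℤ, |D| ≤ C' ∧ ((2 : ℤ) ^ k) ∣ (((ht (σ' i) : ℕ) : ℤ) - b - D)) →
      ∃ n : ℤ, n ≠ 0 ∧ ∀ j : Fin 2, |(n : ℝ) * P (sectorCenter k b) j - V j| ≤ tol := by
    intro σ' hσ' b hb
    obtain ⟨hσp, hon, -⟩ := (hSdef' σ').1 hσ'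
    -- per-leg signs
    have hleg : ∀ i ∈ univ.erase p, ∃ z : ℤ, (z = 1 ∨ z = -1) ∧ ∀ j : Fin 2,
        |(if (σ' i).2 = 0 then P (sectorCenter k (σ' i).1.1) j else -P (sectorCenter k (σ' i).1.1) j) -
          (z : ℝ) * P (sectorCenter k b) j| ≤ Lip * (C' * sectorWidth k) := by
      intro i hi
      have hip : i ≠ p := Finset.ne_of_mem_erase hi
      obtain ⟨D, hD, hdvd⟩ := hb i hip
      obtain ⟨z, hz, hzj⟩ := exists_sign_apply_centre_of_two_pow_dvd P hLip0 hanti hLip (k := k) (a := ht (σ' i)) (b := (b : ℕ)) (D := D) hdvd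
      refine ⟨z, hz, fun j => ?_⟩
      have hsgn := congrFun (signed_eq_halfTurn P hanti k (σ' i).2 ((σ' i).1.1 : ℕ)) j
      have e1 : (if (σ' i).2 = 0 then P (sectorCenter k (σ' i).1.1) j else -P (sectorCenter k (σ' i).1.1) j) =
          (if (σ' i).2 = 0 then P (sectorCenter k (σ' i).1.1) else -P (sectorCenter k (σ' i).1.1)) j := by
        split_ifs <;> rfl
      have hht' : sectorCenter k (if (σ' i).2 = 0 then ((σ' i).1.1 : ℕ) else
          if ((σ' i).1.1 : ℕ) < 2 ^ k then ((σ' i).1.1 : ℕ) + 2 ^ k else ((σ' i).1.1 : ℕ) - 2 ^ k) = sectorCenter k (ht (σ' i)) := by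
        simp only [hht]
      rw [e1, hsgn, hht']
      have hD' : |(D : ℝ)| ≤ C' := by exact_mod_cast hD
      calc |P (sectorCenter k (ht (σ' i))) j - (z : ℝ) * P (sectorCenter k b) j| ≤ Lip * (|(D : ℝ)| * sectorWidth k) := hzj j
        _ ≤ Lip * (C' * sectorWidth k) := by gcongr
    choose! z hz1 hzle using hleg
    refine ⟨∑ i ∈ univ.erase p, z i, ?_, ?_⟩
    swap
    · intro j
      have honj := hon j
      have hsplit : ∑ i, (if (σ' i).2 = 0 then P (sectorCenter k (σ' i).1.1) j else -P (sectorCenter k (σ' i).1.1) j) =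
          (if ℓ.2 = 0 then P (sectorCenter k ℓ.1.1) j else -P (sectorCenter k ℓ.1.1) j) +
            ∑ i ∈ univ.erase p, (if (σ' i).2 = 0 then P (sectorCenter k (σ' i).1.1) j else -P (sectorCenter k (σ' i).1.1) j) := by
        rw [← Finset.add_sum_erase _ _ (mem_univ p), hσp]
      have hcard : ((univ.erase p).card : ℝ) = m := by
        rw [Finset.card_erase_of_mem (mem_univ _), Finset.card_univ, Fintype.card_fin]; simp
      have hrest : |∑ i ∈ univ.erase p, (if (σ' i).2 = 0 then P (sectorCenter k (σ' i).1.1) j else -P (sectorCenter k (σ' i).1.1) j) -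
          ((∑ i ∈ univ.erase p, z i : ℤ) : ℝ) * P (sectorCenter k b) j| ≤ m * (Lip * (C' * sectorWidth k)) := by
        rw [Int.cast_sum, Finset.sum_mul, ← Finset.sum_sub_distrib]
        calc |∑ i ∈ univ.erase p, ((if (σ' i).2 = 0 then P (sectorCenter k (σ' i).1.1) j else -P (sectorCenter k (σ' i).1.1) j) -
                (z i : ℝ) * P (sectorCenter k b) j)|
            ≤ ∑ i ∈ univ.erase p, |(if (σ' i).2 = 0 then P (sectorCenter k (σ' i).1.1) j else -P (sectorCenter k (σ' i).1.1) j) -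
                (z i : ℝ) * P (sectorCenter k b) j| := Finset.abs_sum_le_sum_abs _ _
          _ ≤ ∑ _i ∈ univ.erase p, Lip * (C' * sectorWidth k) := Finset.sum_le_sum fun i hi => hzle i hi j
          _ = m * (Lip * (C' * sectorWidth k)) := by rw [Finset.sum_const, nsmul_eq_mul, hcard]
      rw [hsplit] at honj
      have h3 : |∑ i ∈ univ.erase p, (if (σ' i).2 = 0 then P (sectorCenter k (σ' i).1.1) j else -P (sectorCenter k (σ' i).1.1) j) - V j| ≤
          ((m : ℝ) + 1) * C * sectorWidth k := by
        have e : ∑ i ∈ univ.erase p, (if (σ' i).2 = 0 then P (sectorCenter k (σ' i).1.1) j else -P (sectorCenter k (σ' i).1.1) j) - V j =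
            (if ℓ.2 = 0 then P (sectorCenter k ℓ.1.1) j else -P (sectorCenter k ℓ.1.1) j) +
              ∑ i ∈ univ.erase p, (if (σ' i).2 = 0 then P (sectorCenter k (σ' i).1.1) j else -P (sectorCenter k (σ' i).1.1) j) -
              2 * π * (G₀ j : ℝ) := by rw [hVdef]; ring
        rw [e]; exact honj
      have := abs_sub_le ((((∑ i ∈ univ.erase p, z i : ℤ)) : ℝ) * P (sectorCenter k b) j)
        (∑ i ∈ univ.erase p, (if (σ' i).2 = 0 then P (sectorCenter k (σ' i).1.1) j else -P (sectorCenter k (σ' i).1.1) j)) (V j)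
      rw [abs_sub_comm] at hrest
      have e2 : tol = ((m : ℝ) + 1) * C * sectorWidth k + m * (Lip * (C' * sectorWidth k)) := by rw [htol]; ring
      rw [e2]; linarith
    · -- `n ≠ 0`: otherwise `|V j| ≤ tol` for both `j`, contradicting `hV`
      intro hn0
      obtain ⟨j, hj⟩ := hV
      -- re-derive the estimate at this `j` with `n = 0`
      have honj := hon j
      have hsplit : ∑ i, (if (σ' i).2 = 0 then P (sectorCenter k (σ' i).1.1) j else -P (sectorCenter k (σ' i).1.1) j) =
          (if ℓ.2 = 0 then P (sectorCenter k ℓ.1.1) j else -P (sectorCenter k ℓ.1.1) j) +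
            ∑ i ∈ univ.erase p, (if (σ' i).2 = 0 then P (sectorCenter k (σ' i).1.1) j else -P (sectorCenter k (σ' i).1.1) j) := by
        rw [← Finset.add_sum_erase _ _ (mem_univ p), hσp]
      have hcard : ((univ.erase p).card : ℝ) = m := by
        rw [Finset.card_erase_of_mem (mem_univ _), Finset.card_univ, Fintype.card_fin]; simp
      have hrest : |∑ i ∈ univ.erase p, (if (σ' i).2 = 0 then P (sectorCenter k (σ' i).1.1) j else -P (sectorCenter k (σ' i).1.1) j)| ≤
          m * (Lip * (C' * sectorWidth k)) := by
        have e0 : ∑ i ∈ univ.erase p, (if (σ' i).2 = 0 then P (sectorCenter k (σ' i).1.1) j else -P (sectorCenter k (σ' i).1.1) j) =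
            ∑ i ∈ univ.erase p, ((if (σ' i).2 = 0 then P (sectorCenter k (σ' i).1.1) j else -P (sectorCenter k (σ' i).1.1) j) -
              (z i : ℝ) * P (sectorCenter k b) j) := by
          rw [Finset.sum_sub_distrib, ← Finset.sum_mul, ← Int.cast_sum, hn0, Int.cast_zero, zero_mul, sub_zero]
        rw [e0]
        calc |∑ i ∈ univ.erase p, ((if (σ' i).2 = 0 then P (sectorCenter k (σ' i).1.1) j else -P (sectorCenter k (σ' i).1.1) j) -
                (z i : ℝ) * P (sectorCenter k b) j)|
            ≤ ∑ i ∈ univ.erase p, |(if (σ' i).2 = 0 then P (sectorCenter k (σ' i).1.1) j else -P (sectorCenter k (σ' i).1.1) j) -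
                (z i : ℝ) * P (sectorCenter k b) j| := Finset.abs_sum_le_sum_abs _ _
          _ ≤ ∑ _i ∈ univ.erase p, Lip * (C' * sectorWidth k) := Finset.sum_le_sum fun i hi => hzle i hi j
          _ = m * (Lip * (C' * sectorWidth k)) := by rw [Finset.sum_const, nsmul_eq_mul, hcard]
      rw [hsplit] at honj
      have hVj : |V j| ≤ tol := by
        have e : V j = -((if ℓ.2 = 0 then P (sectorCenter k ℓ.1.1) j else -P (sectorCenter k ℓ.1.1) j) +
            ∑ i ∈ univ.erase p, (if (σ' i).2 = 0 then P (sectorCenter k (σ' i).1.1) j else -P (sectorCenter k (σ' i).1.1) j) -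
            2 * π * (G₀ j : ℝ)) +
            ∑ i ∈ univ.erase p, (if (σ' i).2 = 0 then P (sectorCenter k (σ' i).1.1) j else -P (sectorCenter k (σ' i).1.1) j) := by
          rw [hVdef]; ring
        rw [e]
        refine (abs_add_le _ _).trans ?_
        rw [abs_neg]
        have e2 : tol = ((m : ℝ) + 1) * C * sectorWidth k + m * (Lip * (C' * sectorWidth k)) := by rw [htol]; ring
        rw [e2]; linarith
      rw [hVdef] at hVj
      exact absurd hj (not_lt.2 (by rw [htol] at hVj; exact hVj))
  -- §d every admissible cone sector `b` is within `δ″` of `θ_{b₀}` modulo `π`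
  set δ' : ℝ := π * (2 * tol) / umin with hδ'
  have hδ'0 : 0 ≤ δ' := by positivity
  obtain ⟨n₀, hn₀, hV₀⟩ := hkey σ₀ hσ₀ b₀' hb₀'
  have hnear : ∀ σ' ∈ S, ∀ b : Fin (sectorCount k),
      (∀ i, i ≠ p → ∃ D : ℤ, |D| ≤ C' ∧ ((2 : ℤ) ^ k) ∣ (((ht (σ' i) : ℕ) : ℤ) - b - D)) →
      FermiRG.torusDist (sectorCenter k b - sectorCenter k b₀') ≤ δ' ∨
        FermiRG.torusDist (sectorCenter k b - (sectorCenter k b₀' + π)) ≤ δ' := by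
    intro σ' hσ' b hb
    obtain ⟨n, hn, hVn⟩ := hkey σ' hσ' b hb
    obtain ⟨r, hr, hPr⟩ := hpolar (sectorCenter k b)
    obtain ⟨r₀, hr₀, hPr₀⟩ := hpolar (sectorCenter k b₀')
    have hcl : ∀ j : Fin 2, |(n : ℝ) * P (sectorCenter k b) j - (n₀ : ℝ) * P (sectorCenter k b₀') j| ≤ 2 * tol := by
      intro j
      have h1 := hVn j; have h2 := hV₀ j
      have := abs_sub_le ((n : ℝ) * P (sectorCenter k b) j) (V j) ((n₀ : ℝ) * P (sectorCenter k b₀') j)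
      rw [abs_sub_comm] at h2
      linarith
    have h0' := hcl 0; have h1' := hcl 1
    rw [hPr, hPr₀] at h0' h1'
    simp only [Pi.smul_apply, smul_eq_mul, dir_zero, dir_one] at h0' h1'
    obtain ⟨s, hs, hc, hsn⟩ := int_mul_polar_eq n r (sectorCenter k b)
    obtain ⟨s₀, hs₀, hc₀, hsn₀⟩ := int_mul_polar_eq n₀ r₀ (sectorCenter k b₀')
    rw [hc, hc₀] at h0'
    rw [hsn, hsn₀] at h1'
    have hn1 : (1 : ℝ) ≤ |(n : ℝ)| := by
      have : (1 : ℤ) ≤ |n| := Int.one_le_abs hn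
      have h' : ((1 : ℤ) : ℝ) ≤ ((|n| : ℤ) : ℝ) := by exact_mod_cast this
      rwa [Int.cast_one, Int.cast_abs] at h'
    have hn01 : (1 : ℝ) ≤ |(n₀ : ℝ)| := by
      have : (1 : ℤ) ≤ |n₀| := Int.one_le_abs hn₀
      have h' : ((1 : ℤ) : ℝ) ≤ ((|n₀| : ℤ) : ℝ) := by exact_mod_cast this
      rwa [Int.cast_one, Int.cast_abs] at h'
    have hU : umin ≤ |(n : ℝ)| * r := by nlinarith
    have hU₀ : umin ≤ |(n₀ : ℝ)| * r₀ := by nlinarith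
    have hmain := torusDist_le_of_polar_close humin hU hU₀ h0' h1'
    have hdist : FermiRG.torusDist (sectorCenter k b + s - (sectorCenter k b₀' + s₀)) ≤ δ' := by
      rw [hδ', le_div_iff₀ humin]; linarith
    rcases hs with hs | hs <;> rcases hs₀ with hs₀ | hs₀
    · left; rw [hs, hs₀, add_zero, add_zero] at hdist; exact hdist
    · right; rw [hs, add_zero, hs₀] at hdist; exact hdist
    · right
      rw [hs, hs₀, add_zero] at hdist
      have e : sectorCenter k b + π - sectorCenter k b₀' = (sectorCenter k b - (sectorCenter k b₀' + π)) + (1 : ℤ) * (2 * π) := by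
        push_cast; ring
      rwa [e, torusDist_add_int_mul_two_pi] at hdist
    · left
      rw [hs, hs₀] at hdist
      have e : sectorCenter k b + π - (sectorCenter k b₀' + π) = sectorCenter k b - sectorCenter k b₀' := by ring
      rwa [e] at hdist
  -- §e assemble: `S ⊆ ⋃_{b near θ_{b₀} (mod π)} T b`
  set Badm₁ := (univ : Finset (Fin (sectorCount k))).filter fun b : Fin (sectorCount k) =>
    FermiRG.torusDist (sectorCenter k b - sectorCenter k b₀') ≤ δ' with hBadm₁
  set Badm₂ := (univ : Finset (Fin (sectorCount k))).filter fun b : Fin (sectorCount k) =>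
    FermiRG.torusDist (sectorCenter k b - (sectorCenter k b₀' + π)) ≤ δ' with hBadm₂
  have hcover : S ⊆ (Badm₁ ∪ Badm₂).biUnion T := by
    intro σ' hσ'
    obtain ⟨hσp, -, b, hb⟩ := (hSdef' σ').1 hσ'
    rw [Finset.mem_biUnion]
    refine ⟨b, ?_, ?_⟩
    · rw [Finset.mem_union, hBadm₁, hBadm₂, mem_filter, mem_filter]
      rcases hnear σ' hσ' b hb with h | h
      · exact Or.inl ⟨mem_univ _, h⟩
      · exact Or.inr ⟨mem_univ _, h⟩
    · rw [hT, Fintype.mem_piFinset]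
      intro i
      by_cases hi : i = p
      · rw [if_pos hi, Finset.mem_singleton, hi, hσp]
      · rw [if_neg hi, hLbl, mem_filter]; exact ⟨mem_univ _, hb i hi⟩
  have hB1card : (Badm₁.card : ℝ) ≤ 2 * (2 * δ') / sectorWidth k + 2 :=
    card_sectors_torusDist_le k (sectorCenter k b₀') δ' hδ'0 b₀' (by rw [sub_self, torusDist_zero_eq]; exact hδ'0)
  have hB2card : (Badm₂.card : ℝ) ≤ 2 * (2 * δ') / sectorWidth k + 2 := by
    by_cases hne : Badm₂.Nonempty
    · obtain ⟨b₁, hb₁⟩ := hne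
      have hb₁' : FermiRG.torusDist (sectorCenter k b₁ - (sectorCenter k b₀' + π)) ≤ δ' := by
        rw [hBadm₂, mem_filter] at hb₁; exact hb₁.2
      exact card_sectors_torusDist_le k (sectorCenter k b₀' + π) δ' hδ'0 b₁ hb₁'
    · rw [Finset.not_nonempty_iff_eq_empty] at hne
      rw [hne, Finset.card_empty, Nat.cast_zero]; positivity
  have hB' : 2 * (2 * δ') / sectorWidth k + 2 = 8 * π * (((m : ℝ) + 1) * C + m * Lip * C') / umin + 2 := by
    rw [hδ', htol]; field_simp; ring
  have hX : (0 : ℝ) ≤ (8 * (2 * (C' : ℝ) + 1)) ^ m := by positivity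
  calc ((S.card : ℕ) : ℝ) ≤ (((Badm₁ ∪ Badm₂).biUnion T).card : ℝ) := by exact_mod_cast Finset.card_le_card hcover
    _ ≤ ∑ b ∈ Badm₁ ∪ Badm₂, ((T b).card : ℝ) := by exact_mod_cast Finset.card_biUnion_le
    _ ≤ ∑ _b ∈ Badm₁ ∪ Badm₂, (8 * (2 * (C' : ℝ) + 1)) ^ m := Finset.sum_le_sum fun b _ => hT_card b
    _ = (Badm₁ ∪ Badm₂).card * (8 * (2 * (C' : ℝ) + 1)) ^ m := by rw [Finset.sum_const, nsmul_eq_mul]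
    _ ≤ ((Badm₁.card : ℝ) + Badm₂.card) * (8 * (2 * (C' : ℝ) + 1)) ^ m := by
        apply mul_le_mul_of_nonneg_right _ hX
        exact_mod_cast Finset.card_union_le _ _
    _ ≤ (2 * (8 * π * (((m : ℝ) + 1) * C + m * Lip * C') / umin + 2)) * (8 * (2 * (C' : ℝ) + 1)) ^ m := by
        apply mul_le_mul_of_nonneg_right _ hX
        rw [← hB']; linarith

end Summit.HubbardSuperconductivity.HubbardSuperconductivity.Theorems.PerturbedFermiCurve

end
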